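import Literature.AlgebraicGeometry.ModuliOfAbelianVarieties.SiegelLinearRigidificationBaseChange
import Literature.AlgebraicGeometry.Motives.GeneratingSectionsLinearChange
import Literature.AlgebraicGeometry.Motives.GeneratingSectionsFrameChange
import Literature.AlgebraicGeometry.Motives.GeneratingSectionsFrameIndependence
import Literature.AlgebraicGeometry.Modules.FrameTransition
import HarnessLib

/-!
# Two linear rigidifications of one polarised triple differ by `GL_{m+1}(Γ(T, 𝒪_T))`, Zariski-locally

Topic `AlgebraicGeometry/ModuliOfAbelianVarieties`; namespace
`Literature.AlgebraicGeometry.AbelianSchemes.PolarizedAbelianSchemeWithLevel` (the namespace of ★ (8α)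
`SiegelFramedCovariant` §1 and ★ `SiegelLinearRigidificationBaseChange`).  THEOREMS ONLY (no definition, no instance, no
notation, no named fact, no `sorry`).

[MumfordFogartyKirwan1994] Ch. 7 §2 Def. 7.5 (p. 130): a linear rigidification of `(X, λ)` over `T` is an isomorphism
`ℙ(π_*L^Δ(λ)³) ≅ ℙ^m × T`; two of them differ by a `T`-automorphism of `ℙ^m_T`, i.e. (Zariski-locally on `T`) by a matrix
`M ∈ GL_{m+1}(Γ(T, 𝒪_T))` — the action by which `PGL(m+1)` acts on Prop. 7.3's `H` (p. 132) and Prop. 7.6's functor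
(p. 136).  In the tree's currency (★ (8α) `IsFrameRigidification` / `IsLinearRigidification`: a rigidification is recorded by
the morphism `ι : X → 𝐏^m_ℤ` of a frame of `π_*(L^Δ(λ)^{⊗3})`; the acted morphism is the `S`-free `M • ι :=
⟨X → Spec Γ(X, 𝒪_X), ι⟩ ≫ actCore M` of ★ (8β-a) `Morphisms/ProjectiveFrameLocusLinearInvariance`):

* §1 **`exists_GL_of_isFrameRigidification`** — two GLOBAL frame rigidifications `ι`, `ι'` of one triple `P/T` satisfy
  `ι' = (π^* M) • ι` for some `M ∈ GL_{m+1}(Γ(T, 𝒪_T))`: the graph `(1, λ)` is unique (`pullback.hom_ext`), the datum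
  does not see the frame system (★ `ofCocycleSections_ofFrameSystem_eq`, ★ (W) `iSup_basicOpen_coeff_eq_top_of_iso`),
  the two frames of `π_* L` differ by their transition matrix (★ `Modules/FrameTransition.transition`,
  `map_basisSection_eq_sum_transition`, `transition_mul_symm`; `M = ᵀT(e, e')`), and a linear change of generating
  sections moves the morphism by the matrix (★ (U-a) `toProj_ofFrameSystem_eq_lift_actCore_of_eq_sum_smul`);
* §2 **`exists_openCover_GL_of_isLinearRigidification`** — two LINEAR rigidifications `κ`, `κ'` of `Q/S` (`S` locally
  Noetherian) agree up to `GL_{m+1}` on a common refinement `𝒰 ×_S 𝒰'` of their frame covers: on a member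
  `V = 𝒰ᵢ ×_S 𝒰'ᵢ'` both restrictions are global frame rigidifications of `Q|_V` (★ frame transport along relations
  `IsBaseChangeVia.isFrameRigidification_comp`, relations by ★ cancellation `exists_isBaseChangeVia_of_comp`), then §1.
  This is VERBATIM the socket `hGL` of (8β-b) `SiegelModuliFrameSubfunctor` / (8ε) and the input of the (8γ)
  uniqueness half.

Cell hodgecm-mathlib (D-0151), F-8 REOPENED (director s231), brick (U-b) of the (8γ-U) path (B-p01 (g14)).  Count-neutral
capital: HC_CM is proved only modulo the 7 printed citations until rung 0 closes — nothing here is about HC.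

## References
* [MumfordFogartyKirwan1994] D. Mumford, J. Fogarty, F. Kirwan, *Geometric Invariant Theory*, 3rd ed. (1994): Ch. 7 §2
  Def. 7.5 (p. 130), Prop. 7.3 (p. 132), Prop. 7.6 (p. 136).
* [Hartshorne1977] R. Hartshorne, *Algebraic Geometry* (1977): II Thm. 7.1 (p. 150), II Example 7.1.1 (p. 151).
-/

noncomputable section

-- Mathlib's pull-back / `Scheme.Modules` section API is stated across semireducible wrappers (as in the tree's
-- functor-side and action files).
set_option backward.isDefEq.respectTransparency false

open CategoryTheory CategoryTheory.Limits AlgebraicGeometry Matrix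
open Literature.AlgebraicGeometry.Modules
open Literature.AlgebraicGeometry.Motives Literature.AlgebraicGeometry.Motives.GeneratingSections
open Literature.AlgebraicGeometry.Morphisms (intU projectiveSpaceInt isPullback_projToSpec_projMap_terminal)
open Literature.AlgebraicGeometry.GroupSchemes.GeneralLinearGroupScheme (intCast actCore)

namespace Literature.AlgebraicGeometry.AbelianSchemes

namespace PolarizedAbelianSchemeWithLevel

variable {g N : ℕ} {δ : Fin g → ℕ} {J : Type}

/-! ### §1 Two GLOBAL frames: `ι' = M • ι` for a matrix over the base -/

section Global

variable {T : Scheme.{0}} (P : PolarizedAbelianSchemeWithLevel g N δ T)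

/-- **Two GLOBAL frame rigidifications of one triple differ by a matrix over the base**: if `ι`, `ι' : X → 𝐏^m_ℤ` are
the morphisms of global frames of `π_*(L^Δ(λ)^{⊗3})` ([MumfordFogartyKirwan1994] Def. 7.5: two linear rigidifications
`ℙ(π_*L^Δ(λ)³) ≅ ℙ^m × T` differ by an element of `PGL(m+1)(T)`), then `ι' = (π^* M) • ι` for some
`M ∈ GL_{m+1}(Γ(T, 𝒪_T))` — the transpose of the transition matrix of the two frames; `•` is the `S`-free acted point of
★ `Morphisms/ProjectiveFrameLocusLinearInvariance` (Hartshorne II Example 7.1.1: `x'_i = Σ a_{ij} x_j`).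
[cite: MumfordFogartyKirwan1994, Ch. 7 §2 Def. 7.5 (p. 130)] [cite: Hartshorne1977, II Example 7.1.1 (p. 151)] -/
theorem exists_GL_of_isFrameRigidification {ι ι' : P.A.X.left ⟶ projectiveSpaceInt J}
    (h : P.IsFrameRigidification J ι) (h' : P.IsFrameRigidification J ι') :
    ∃ M : GL (Fin (Nat.card J + 1)) Γ(T, ⊤),
      letI : Algebra intU.{0} Γ(P.A.X.left, ⊤) := (intCast _).toAlgebra
      ι' = (isPullback_projToSpec_projMap_terminal J Γ(P.A.X.left, ⊤)).lift P.A.X.left.toSpecΓ ι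
          (terminal.hom_ext _ _) ≫ actCore J (Matrix.GeneralLinearGroup.map P.A.X.hom.appTop.hom M) := by
  classical
  letI : Algebra intU.{0} Γ(P.A.X.left, ⊤) := (intCast _).toAlgebra
  obtain ⟨Gr, hGr₁, hGr₂, F, h1, e, hcov, hι⟩ := h
  obtain ⟨Gr', hGr'₁, hGr'₂, F', h1', e', hcov', hι'⟩ := h'
  obtain rfl : Gr' = Gr := pullback.hom_ext (hGr'₁.trans hGr₁.symm) (hGr'₂.trans hGr₂.symm)
  rw [Morphisms.projectiveSpace.homEquiv_pointOfSections] at hι hι'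
  -- (ii) read the second family of sections in the FIRST frame system
  have hid : ∀ j, (Iso.refl (tensorPow ((Scheme.Modules.pullback Gr').obj P.D.P) 3)).hom.app ⊤ (basisSection e' j :) =
      (basisSection e' j :) := fun j => rfl
  have hcov'' : ⨆ i, ⨆ x, P.A.X.left.basicOpen
      ((CocycleSections.ofFrameSystem F h1 fun j => (basisSection e' j :)).coeff i x) = ⊤ := by
    have h := iSup_basicOpen_coeff_eq_top_of_iso (Iso.refl _) F' F h1' h1 (fun j => (basisSection e' j :)) hcov'
    simp only [hid] at h
    exact h
  have key : ofCocycleSections F'.U (CocycleSections.ofFrameSystem F' h1' fun j => (basisSection e' j :)) hcov' =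
      ofCocycleSections F.U (CocycleSections.ofFrameSystem F h1 fun j => (basisSection e' j :)) hcov'' :=
    ofCocycleSections_ofFrameSystem_eq F' F h1' h1 _ hcov' hcov''
  -- (iii) the transition matrix of the two frames `e`, `e'` of `π_* L` over `T`
  set τ : Matrix (Fin (Nat.card J + 1)) (Fin (Nat.card J + 1)) Γ(T, ⊤) :=
    transition e e' (𝟙 (⊤ : T.Opens)) (𝟙 (⊤ : T.Opens)) with hτdef
  set τ' : Matrix (Fin (Nat.card J + 1)) (Fin (Nat.card J + 1)) Γ(T, ⊤) :=
    transition e' e (𝟙 (⊤ : T.Opens)) (𝟙 (⊤ : T.Opens)) with hτ'def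
  have hττ' : τ * τ' = 1 := transition_mul_symm e e' _ _
  have hτ'τ : τ' * τ = 1 := transition_mul_symm e' e _ _
  let M : GL (Fin (Nat.card J + 1)) Γ(T, ⊤) :=
    ⟨τᵀ, τ'ᵀ, by rw [← Matrix.transpose_mul, hτ'τ, Matrix.transpose_one],
      by rw [← Matrix.transpose_mul, hττ', Matrix.transpose_one]⟩
  refine ⟨M, ?_⟩
  rw [← hι', ← hι, key]
  refine toProj_ofFrameSystem_eq_lift_actCore_of_eq_sum_smul J
    (Matrix.GeneralLinearGroup.map P.A.X.hom.appTop.hom M) F h1 (fun j => (basisSection e j :))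
    (fun j => (basisSection e' j :)) (fun j => ?_) hcov hcov'' _
  -- `b'_j = Σ_k τ_{kj} b_k`: the sections `basisSection e'` are the `(π^* M)`-transform of `basisSection e`, `M = τᵀ`
  have hb := map_basisSection_eq_sum_transition e e' (𝟙 (⊤ : T.Opens)) (𝟙 (⊤ : T.Opens)) j
  simp only [op_id, CategoryTheory.Functor.map_id, CategoryTheory.id_apply] at hb
  exact hb

end Global

/-! ### §2 Two LINEAR rigidifications: Zariski-locally `κ' = M • κ` (the (8β-b)/(8γ) socket `hGL`) -/

section Local

/-- **Two LINEAR RIGIDIFICATIONS of one triple differ Zariski-locally by `GL_{m+1}(Γ(·, 𝒪))`** — the socket `hGL` of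
(8β-b) `SiegelModuliFrameSubfunctor` («any local rigidification computes the frame locus `U_R`», [MumfordFogartyKirwan1994]
Prop. 7.6 p. 136 / Ch. 3 Prop. 3.1: `U_R` is `PGL(m+1)`-stable) and of the (8γ) slice uniqueness: for `κ`, `κ'` linear
rigidifications of `Q/S`, `S` locally Noetherian, there is an open cover `𝒰` of `S` (the common refinement of the two
frame covers) with matrices `Mᵢ ∈ GL_{m+1}(Γ(𝒰ᵢ, 𝒪))` such that `κ'|_{X ×_S 𝒰ᵢ} = (πᵢ^* Mᵢ) • κ|_{X ×_S 𝒰ᵢ}` (§1 on each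
member, after ★ `IsBaseChangeVia.isFrameRigidification_comp` makes both restrictions global frame rigidifications of `Q|_{𝒰ᵢ}`).
[cite: MumfordFogartyKirwan1994, Ch. 7 §2 Def. 7.5 (p. 130) and Prop. 7.6 (p. 136)] [cite: Hartshorne1977, II Example 7.1.1 (p. 151)] -/
theorem exists_openCover_GL_of_isLinearRigidification ⦃S : Scheme.{0}⦄ [IsLocallyNoetherian S]
    (Q : PolarizedAbelianSchemeWithLevel g N δ S) (κ κ' : Q.A.X.left ⟶ projectiveSpaceInt J)
    (h : Q.IsLinearRigidification J κ) (h' : Q.IsLinearRigidification J κ') :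
    ∃ 𝒰 : Scheme.OpenCover.{0} S, ∀ i, ∃ M : GL (Fin (Nat.card J + 1)) Γ(𝒰.X i, ⊤),
      letI : Algebra intU.{0} Γ((Q.baseChange (𝒰.f i)).A.X.left, ⊤) := (intCast _).toAlgebra
      pullback.fst Q.A.X.hom (𝒰.f i) ≫ κ' =
        (isPullback_projToSpec_projMap_terminal J Γ((Q.baseChange (𝒰.f i)).A.X.left, ⊤)).lift
            (Q.baseChange (𝒰.f i)).A.X.left.toSpecΓ (pullback.fst Q.A.X.hom (𝒰.f i) ≫ κ) (terminal.hom_ext _ _) ≫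
          actCore J (Matrix.GeneralLinearGroup.map (Q.baseChange (𝒰.f i)).A.X.hom.appTop.hom M) := by
  obtain ⟨𝒰, h𝒰⟩ := h
  obtain ⟨𝒰', h𝒰'⟩ := h'
  refine ⟨𝒰.inter 𝒰', fun ii' => ?_⟩
  obtain ⟨i, i'⟩ := ii'
  haveI : IsLocallyNoetherian (𝒰.X i) := isLocallyNoetherian_of_isOpenImmersion (𝒰.f i)
  haveI : IsLocallyNoetherian (𝒰'.X i') := isLocallyNoetherian_of_isOpenImmersion (𝒰'.f i')
  -- the member `V = 𝒰ᵢ ×_S 𝒰'ᵢ'` of the common refinement (`v = fst ≫ 𝒰.f i = snd ≫ 𝒰'.f i'`):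
  -- `Q|_V` is related to `Q|_{𝒰ᵢ}` along `fst` and to `Q|_{𝒰'ᵢ'}` along `snd` (cancel ★ against `Q|_V → Q`)
  have h₁ : (Q.baseChange ((𝒰.inter 𝒰').f (i, i'))).IsBaseChangeVia Q (pullback.fst (𝒰.f i) (𝒰'.f i') ≫ 𝒰.f i)
      (pullback.fst Q.A.X.hom _) (pullback.fst Q.D.hat.X.hom _) :=
    Q.baseChange_isBaseChangeVia _
  have h₁' : (Q.baseChange ((𝒰.inter 𝒰').f (i, i'))).IsBaseChangeVia Q (pullback.snd (𝒰.f i) (𝒰'.f i') ≫ 𝒰'.f i')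
      (pullback.fst Q.A.X.hom _) (pullback.fst Q.D.hat.X.hom _) := by
    rw [← pullback.condition]
    exact Q.baseChange_isBaseChangeVia _
  obtain ⟨m, mh, hmG, -, hm⟩ := exists_isBaseChangeVia_of_comp h₁ (Q.baseChange_isBaseChangeVia (𝒰.f i))
  obtain ⟨m', mh', hmG', -, hm'⟩ := exists_isBaseChangeVia_of_comp h₁' (Q.baseChange_isBaseChangeVia (𝒰'.f i'))
  -- both `κ|_V`, `κ'|_V` are GLOBAL frame rigidifications of `Q|_V` (★ frame transport along relations)
  have hF : (Q.baseChange ((𝒰.inter 𝒰').f (i, i'))).IsFrameRigidification J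
      (pullback.fst Q.A.X.hom ((𝒰.inter 𝒰').f (i, i')) ≫ κ) := by
    have key := hm.isFrameRigidification_comp (h𝒰 i)
    exact (reassoc_of% hmG) κ ▸ key
  have hF' : (Q.baseChange ((𝒰.inter 𝒰').f (i, i'))).IsFrameRigidification J
      (pullback.fst Q.A.X.hom ((𝒰.inter 𝒰').f (i, i')) ≫ κ') := by
    have key := hm'.isFrameRigidification_comp (h𝒰' i')
    exact (reassoc_of% hmG') κ' ▸ key
  exact exists_GL_of_isFrameRigidification _ hF hF'

end Local

end PolarizedAbelianSchemeWithLevel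

end Literature.AlgebraicGeometry.AbelianSchemes

end
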